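import Literature.MathematicalPhysics.QuantumFieldTheory.Balaban1983to89.B9Eq33CovDerivVector

/-!
# `Balaban1983to89.B9Eq34CovCurlVector` — T. Bałaban, *Propagators for lattice gauge theories in a background field*, Commun. Math.
# Phys. **99** (1985) 389–434 [Balaban1985BackgroundPropagators], (3.4) p. 391 and (3.9)–(3.10) p. 392: the COVARIANT CURL
# `(DA)(p_{μν}(x)) = (D_μA_ν)(x) − (D_νA_μ)(x)` of a FIBRE-VALUED bond function, its ADJOINT `D*` on plaquette functions (3.9) with the
# `ℓ²`-adjointness, the composite `D*D` = the principal part of the operator `Δ` of (3.10) with `⟨A, D*DA⟩ = Σ_p |(DA)(p)|² ≥ 0`, and the exact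
# identity `D(Df) =` holonomy defect — as LINEAR MAPS on the periodic lattice of `B9SectCLatticeCarrier`, transporters as linear data

statement-level skeleton of published theorems with citation tags; proofs where landed; nothing here is a claim
about the Yang–Mills mass gap

PDF held: `paper:balaban1985-cmp99-background-propagators` (journal page = PDF page + 388); pp. 391–392 (PDF 3–4) read from the held text by
this seat (`lit read`, 2026-08-21); the verbatim setting of (3.3)–(3.5), (3.8)–(3.9) is quoted in the headers of `B9Eq33CovDerivVector` and
`B8CurlGradHolonomy`.

THE PRINT (verbatim, p. 391–392).  *«For a function A defined at bonds of the lattice we put (D^η_{U₀}A)(p) = η⁻¹(A(x, y) + R(U₀(x, y))A(y, z) +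
R(U₀(x, w))A(z, w) + A(w, x)) (3.4) for a plaquette p = ⟨x, y, z, w⟩, and if p = p_{μν}(x) = ⟨x, x + ηe_μ, x + ηe_μ + ηe_ν, x + ηe_ν⟩, then we
have (D^η_{U₀}A)(p_{μν}(x)) = (D^η_{U₀}A)_{μν}(x) = (D^η_{U₀,μ}A_ν)(x) − (D^η_{U₀,ν}A_μ)(x). We have made here the identification A(x, x + ηe_μ) =
A_μ(x).»*  p. 392: *«The operator adjoint to derivative D, acting on functions defined at bonds, is the operator acting on functions F defined at
plaquetts by the formula (D*F)(x, x + ηe_μ) = (D*F)_μ(x) = Σ_{ν<μ}(D*_νF_{νμ})(x) − Σ_{ν>μ}(D*_νF_{μν})(x) = Σ_{ν=1}^{d}(D*_νF_{νμ})(x), (3.9) where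
F_{μν}(x) = F(p_{μν}(x)), and in the last equality above we have assumed that F_{μν}(x) = −F_{νμ}(x). The quadratic terms in the expansion
(3.7) define the basic operator generalizing the operator ∂*∂ in the Abelian case. We denote it by Δ^η(U), or simply by Δ. For U with
values in the unitary group U(N) it is a hermitian operator given by the quadratic form ⟨A, ΔA⟩ = Σ_p η^d |(DA)(p)|² + … (3.10)»* (the
remaining terms of (3.10), the curvature commutators `Δ′`, are NOT typed here).

WHY THIS FILE (cell context).  Third brick, after `B11Eq115Space` (the normed carriers, (L1)) and `B9Eq33CovDerivVector` ((3.3) `D` and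
(3.8) `D*` as linear maps, (L1′)), toward the B9 Sect. A–D operators that the B2′ letters (L2) 𝔊 = G₁𝔓*, (L4) H, (L6) H₁ of the pub-balaban NE9
letter map are built from (`G₁ = (Δ₁ + DRD* + Q*aQ)⁻¹`): the curl `D` on 1-forms, its adjoint, and the principal part `D*D` of `Δ`.  The tree
types (3.4) in SCALAR reading (`B9SectCLatticeCarrier` §4: `pT`, `pJ`, `pD_mulVec`, `curl_mulVec`) and in the abstract ACTION reading
(`B8CurlGradHolonomy.covCurl`, one plaquette, η = 1, with `covCurl_covD_covD` = the holonomy defect); this file gives the fibre-valued linear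
map on the whole lattice and proves agreement with both (`covCurl_scalar`, `covCurl_eq_smul_B8covCurl`).

WHAT IS DEFINED AND PROVED (sorry-free; no `Prop` placeholder; no inequality of the paper).
* §0 `shift_comm` — the two unit steps of a plaquette commute on `Π_i ℤ/P_iℤ`.
* §1 `covCurl c R : (Bond d Pd → V) →ₗ[𝕜] (Plaq d Pd → V)` — (3.4) in components, `covCurl_apply(_coord)`; **`covCurl_scalar`** (= the tree's
  `curl_mulVec` for `V = ℝ`, `R = r·id`); **`covCurl_eq_smul_B8covCurl`** (= `c • B8CurlGradHolonomy.covCurl …` for a monoid action);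
  `covCurl_adTransport_apply` (𝔤-valued, `R(U)X = UXU⁻¹`).
* §2 **`covCurl_covDeriv`** — `(D(Df))(p_{μν}(x)) = c²·[(R(x,μ)∘R(x+e_μ,ν) − R(x,ν)∘R(x+e_ν,μ)) f(x+e_μ+e_ν)]` (all first-order terms cancel);
  `covCurl_covDeriv_eq_zero_of_flat` / `covCurl_covDeriv_flat` (trivial holonomy ⇒ `D∘D = 0`); `covCurl_covDeriv_adTransport` (conjugation form).
* §3 `covCoCurl c S : (Plaq d Pd → V) →ₗ[𝕜] (Bond d Pd → V)` — (3.9) with the backward differences of (3.8), adjoint transporters `S` a datum;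
  **`sum_inner_covCurl_eq_sum_inner_covCoCurl`**: `Σ_p ⟪F(p), (DA)(p)⟫ = Σ_b ⟪(D*F)(b), A(b)⟫` on the periodic lattice for real-inner-product fibres and
  mutually adjoint transporter data (`⟪w, R(b)v⟫ = ⟪S(b)w, v⟫` — print's unitary `R(U(b))`, `S = R⁻¹`) — (3.9) IS the adjoint, PROVED (fibrewise
  summation over the ordered pairs + re-indexing along `shiftEquiv`); `covLapPrincipal c R S := D* ∘ D` with **`sum_inner_covLapPrincipal`**:
  `Σ_b ⟪(D*DA)(b), A(b)⟫ = Σ_p ‖(DA)(p)‖²` (the first term of (3.10)) and `sum_inner_covLapPrincipal_nonneg` (positive semidefinite).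

MODEL / DECLARED READINGS.  (M1) LATTICE and bond conventions of `B9SectCLatticeCarrier` (plaquettes `p_{μν}(x)`, `μ < ν`, as `TSite × DirPair`;
positively oriented objects only — the antisymmetric extension `F_{μν} = −F_{νμ}` of (3.9) is replaced by the explicit two-branch sum over ordered
pairs, which is what the printed middle member says).  (M2) TRANSPORTERS AS DATA (`R` for `D`, `S` for `D*`); the adjointness hypothesis
`⟪w, R(b)v⟫ = ⟪S(b)w, v⟫` is print's unitarity of `R(U(b))` read on the fibre; REAL inner products (print: *«natural L² scalar products for
functions with values in N × N hermitian matrices»*, p. 391).  (M3) UNIFORM WEIGHTS: the common factor `η^d` of the pairings and the `η`-powers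
are carried by the scalar `c` (= η⁻¹) only.  (M4) NOT TYPED: the curvature part `Δ′` of (3.10), the current (3.11), `Δ_π`, `G`, `Q`, `R_k` —
the next bricks.
HONEST SCOPE.  Exact finite-dimensional lattice identities (definitions with bodies + adjointness / cancellation lemmas) realising printed
FORMULAS as objects; no estimate of the paper (Sect. B–E) is touched; NOT summit progress (cell pub-balaban: NE9 NOT PRINTED / NOT PROVED;
spine PROVED 0/9).  Filed by the pub-balaban NE9 BINDER-row owner lineage `b2b-balaban-t4-ne9-p1` (gen 76); a NEW file importing
`B9Eq33CovDerivVector` only; nothing of lit-balaban's is modified.  Net new unproved facts: 0.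
-/

noncomputable section

namespace Literature.MathematicalPhysics.QuantumFieldTheory.Balaban1983to89.B9Eq34CovCurlVector

open B9SectCLatticeCarrier (Bond Plaq DirPair bpos btgt shift unshift pT pJ curl_mulVec shift_apply_val shift_apply_ne)
open B9Eq33CovDerivVector (covDeriv covGrad covDeriv_apply covDeriv_apply_dir covGrad_apply covGrad_apply_dir adTransport
  adTransport_apply)
open B4Sect5Torus (TSite)

variable {d : ℕ} {Pd : Fin d → ℕ} {𝕜 : Type*} [CommRing 𝕜] {V : Type*} [AddCommGroup V] [Module 𝕜 V]

/-! ## §0 The two unit steps of a plaquette commute on the periodic lattice -/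

/-- `(x + e_ν) + e_μ = (x + e_μ) + e_ν` on `Π_i ℤ/P_iℤ`: the far corner `x + ηe_μ + ηe_ν` of the plaquette `p_{μν}(x)` of (3.4) is reached either way.
[cite: Balaban1985BackgroundPropagators, (3.4) p.391] -/
theorem shift_comm (μ ν : Fin d) (x : TSite d Pd) : shift μ (shift ν x) = shift ν (shift μ x) := by
  by_cases h : μ = ν
  · rw [h]
  · funext i
    apply Fin.ext
    by_cases hiμ : i = μ
    · subst hiμ
      rw [shift_apply_val, shift_apply_ne h, shift_apply_ne h, shift_apply_val]
    · by_cases hiν : i = ν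
      · subst hiν
        rw [shift_apply_ne hiμ, shift_apply_val, shift_apply_val, shift_apply_ne hiμ]
      · rw [shift_apply_ne hiμ, shift_apply_ne hiν, shift_apply_ne hiν, shift_apply_ne hiμ]

/-! ## §1 (3.4): the covariant exterior derivative (curl) of a fibre-valued bond function, as a linear map -/

/-- **The covariant curl (3.4) of a fibre-valued bond function**, in components (the display following (3.4), p. 391):
`(DA)(p_{μν}(x)) = (D_μ A_ν)(x) − (D_ν A_μ)(x)` with `(D_μ A_ν)(x) = c·(R(⟨x, x+e_μ⟩) A_ν(x + e_μ) − A_ν(x))` — i.e. the difference of the two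
components `((x,μ),ν)` and `((x,ν),μ)` of `B9Eq33CovDerivVector.covGrad c R A`; plaquettes `p_{μν}(x)`, `μ < ν`, indexed by
`B9SectCLatticeCarrier.Plaq d Pd`; the transporter `R` a linear DATUM. [cite: Balaban1985BackgroundPropagators, (3.4) p.391] -/
def covCurl (c : 𝕜) (R : Bond d Pd → V →ₗ[𝕜] V) : (Bond d Pd → V) →ₗ[𝕜] (Plaq d Pd → V) where
  toFun A p := covGrad c R A ((p.1, p.2.1.1), p.2.1.2) - covGrad c R A ((p.1, p.2.1.2), p.2.1.1)
  map_add' A B := by funext p; simp only [map_add, Pi.add_apply]; abel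
  map_smul' a A := by funext p; simp only [map_smul, Pi.smul_apply, RingHom.id_apply, smul_sub]

/-- Unfolding (3.4) through the two covariant differences. [cite: Balaban1985BackgroundPropagators, (3.4) p.391] -/
theorem covCurl_apply (c : 𝕜) (R : Bond d Pd → V →ₗ[𝕜] V) (A : Bond d Pd → V) (x : TSite d Pd) (q : DirPair d) :
    covCurl c R A (x, q) = covGrad c R A ((x, q.1.1), q.1.2) - covGrad c R A ((x, q.1.2), q.1.1) := rfl

/-- **(3.4) in coordinates**: `(DA)(p_{μν}(x)) = c·(R(x,μ)A(x+e_μ, ν) − A(x, ν)) − c·(R(x,ν)A(x+e_ν, μ) − A(x, μ))`.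
[cite: Balaban1985BackgroundPropagators, (3.4) p.391] -/
theorem covCurl_apply_coord (c : 𝕜) (R : Bond d Pd → V →ₗ[𝕜] V) (A : Bond d Pd → V) (x : TSite d Pd) (q : DirPair d) :
    covCurl c R A (x, q) =
      c • (R (x, q.1.1) (A (shift q.1.1 x, q.1.2)) - A (x, q.1.2)) - c • (R (x, q.1.2) (A (shift q.1.2 x, q.1.1)) - A (x, q.1.1)) := by
  rw [covCurl_apply, covGrad_apply_dir, covGrad_apply_dir]

/-- **Consistency with the tree's SCALAR READING of (3.4)** (`B9SectCLatticeCarrier.curl_mulVec`): for `V = ℝ` and `R(b) = r(b)·id` the curl here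
IS the matrix `Σ_k (pT c r k − pJ c k)` there applied to `A`. [cite: Balaban1985BackgroundPropagators, (3.4) p.391] -/
theorem covCurl_scalar (c : ℝ) (r : Bond d Pd → ℝ) (A : Bond d Pd → ℝ) (x : TSite d Pd) (q : DirPair d) :
    covCurl c (fun b => r b • (LinearMap.id : ℝ →ₗ[ℝ] ℝ)) A (x, q) = (∑ k, (pT c r k - pJ c k)).mulVec A (x, q) := by
  rw [curl_mulVec, covCurl_apply_coord]
  simp only [LinearMap.smul_apply, LinearMap.id_apply, smul_eq_mul]

/-- **Consistency with the tree's ACTION READING** (`B8CurlGradHolonomy.covCurl sμ sν Uμ Uν Aμ Aν x`, η = 1): for a monoid acting on the fibre and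
`R(x, κ) = (U(x, κ) • ·)`, the curl here at `p_{μν}(x)` is `c •` that `covCurl` along the shifts `e_μ`, `e_ν` with the components `A_μ = A(·, μ)`,
`A_ν = A(·, ν)`. [cite: Balaban1985BackgroundPropagators, (3.4) p.391] -/
theorem covCurl_eq_smul_B8covCurl {M : Type*} [Monoid M] [DistribMulAction M V] [SMulCommClass M 𝕜 V] (c : 𝕜)
    (U : Bond d Pd → M) (A : Bond d Pd → V) (x : TSite d Pd) (q : DirPair d) :
    covCurl c (fun b => DistribSMul.toLinearMap 𝕜 V (U b)) A (x, q) =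
      c • B8CurlGradHolonomy.covCurl (shift q.1.1) (shift q.1.2) (fun y => U (y, q.1.1)) (fun y => U (y, q.1.2))
        (fun y => A (y, q.1.1)) (fun y => A (y, q.1.2)) x := by
  rw [covCurl_apply_coord, B8CurlGradHolonomy.covCurl_apply, DistribSMul.toLinearMap_apply, DistribSMul.toLinearMap_apply]
  simp only [smul_sub]

/-- With 𝔤-valued functions in a unit-valued background (`R = adTransport U₀`): `(DA)(p_{μν}(x)) = c·(U₀(x,μ)A_ν(x+e_μ)U₀(x,μ)⁻¹ − A_ν(x)) −
c·(U₀(x,ν)A_μ(x+e_ν)U₀(x,ν)⁻¹ − A_μ(x))`. [cite: Balaban1985BackgroundPropagators, (3.4) p.391] -/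
theorem covCurl_adTransport_apply {𝔸 : Type*} [Ring 𝔸] [Algebra 𝕜 𝔸] (c : 𝕜) (U : Bond d Pd → 𝔸ˣ) (A : Bond d Pd → 𝔸)
    (x : TSite d Pd) (q : DirPair d) :
    covCurl c (adTransport (𝕜 := 𝕜) U) A (x, q) =
      c • ((U (x, q.1.1) : 𝔸) * A (shift q.1.1 x, q.1.2) * ((U (x, q.1.1))⁻¹ : 𝔸ˣ) - A (x, q.1.2)) -
        c • ((U (x, q.1.2) : 𝔸) * A (shift q.1.2 x, q.1.1) * ((U (x, q.1.2))⁻¹ : 𝔸ˣ) - A (x, q.1.1)) := by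
  rw [covCurl_apply_coord, adTransport_apply, adTransport_apply]

/-! ## §2 Curl of a gradient: the holonomy defect (all first-order terms cancel) -/

/-- **`D(Df)` on a plaquette is the HOLONOMY DEFECT of `f` at the far corner**: for every site function `f` and linear transporter data `R`,
`(D(Df))(p_{μν}(x)) = c²·[(R(x,μ)∘R(x+e_μ,ν) − R(x,ν)∘R(x+e_ν,μ)) f(x + e_μ + e_ν)]` — the transports of `f(z)` along the two lattice paths from the
far corner `z` to `x`, differenced; no first-order term survives (the exact identity behind B9 (3.4)∘(3.3); cf. `B8CurlGradHolonomy.covCurl_covD_covD`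
in the action reading). [cite: Balaban1985BackgroundPropagators, (3.3)–(3.4) p.391] -/
theorem covCurl_covDeriv (c : 𝕜) (R : Bond d Pd → V →ₗ[𝕜] V) (f : TSite d Pd → V) (x : TSite d Pd) (q : DirPair d) :
    covCurl c R (covDeriv c R f) (x, q) =
      (c * c) • (R (x, q.1.1) (R (shift q.1.1 x, q.1.2) (f (shift q.1.2 (shift q.1.1 x)))) -
        R (x, q.1.2) (R (shift q.1.2 x, q.1.1) (f (shift q.1.2 (shift q.1.1 x))))) := by
  rw [covCurl_apply_coord, covDeriv_apply_dir, covDeriv_apply_dir, covDeriv_apply_dir, covDeriv_apply_dir, shift_comm q.1.1 q.1.2 x]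
  simp only [map_sub, map_smul, smul_sub, mul_smul]
  abel

/-- **Curvature-free ⇒ `D∘D = 0`**: if the two path transports around `p_{μν}(x)` agree (`R(x,μ)∘R(x+e_μ,ν) = R(x,ν)∘R(x+e_ν,μ)` — trivial plaquette
holonomy, e.g. the flat background `U₀ = 1`), then `(D(Df))(p_{μν}(x)) = 0`. [cite: Balaban1985BackgroundPropagators, (3.3)–(3.4) p.391] -/
theorem covCurl_covDeriv_eq_zero_of_flat (c : 𝕜) (R : Bond d Pd → V →ₗ[𝕜] V) (f : TSite d Pd → V) (x : TSite d Pd) (q : DirPair d)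
    (hflat : (R (x, q.1.1)).comp (R (shift q.1.1 x, q.1.2)) = (R (x, q.1.2)).comp (R (shift q.1.2 x, q.1.1))) :
    covCurl c R (covDeriv c R f) (x, q) = 0 := by
  have h := LinearMap.congr_fun hflat (f (shift q.1.2 (shift q.1.1 x)))
  simp only [LinearMap.comp_apply] at h
  rw [covCurl_covDeriv, h, sub_self, smul_zero]

/-- In particular for the TRIVIAL transporter (`U₀ = 1`): the lattice curl of the lattice gradient vanishes identically.
[cite: Balaban1985BackgroundPropagators, (3.3)–(3.4) p.391] -/
theorem covCurl_covDeriv_flat (c : 𝕜) (f : TSite d Pd → V) (p : Plaq d Pd) :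
    covCurl c (fun _ => LinearMap.id) (covDeriv c (fun _ => LinearMap.id) f) p = 0 := by
  obtain ⟨x, q⟩ := p
  exact covCurl_covDeriv_eq_zero_of_flat c _ f x q rfl

/-- 𝔤-valued functions, unit-valued background: `(D(Df))(p_{μν}(x)) = c²·(W₁ f(z) W₁⁻¹ − W₂ f(z) W₂⁻¹)` with the two path transports
`W₁ = U₀(x,μ)U₀(x+e_μ,ν)`, `W₂ = U₀(x,ν)U₀(x+e_ν,μ)` from the far corner `z = x + e_μ + e_ν` — conjugation by the plaquette holonomy `W₁W₂⁻¹ = U₀(∂p)`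
measures the defect. [cite: Balaban1985BackgroundPropagators, (3.3)–(3.4) p.391] -/
theorem covCurl_covDeriv_adTransport {𝔸 : Type*} [Ring 𝔸] [Algebra 𝕜 𝔸] (c : 𝕜) (U : Bond d Pd → 𝔸ˣ) (f : TSite d Pd → 𝔸)
    (x : TSite d Pd) (q : DirPair d) :
    covCurl c (adTransport (𝕜 := 𝕜) U) (covDeriv c (adTransport (𝕜 := 𝕜) U) f) (x, q) =
      (c * c) • ((U (x, q.1.1) * U (shift q.1.1 x, q.1.2) : 𝔸ˣ) * f (shift q.1.2 (shift q.1.1 x)) *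
            ((U (x, q.1.1) * U (shift q.1.1 x, q.1.2))⁻¹ : 𝔸ˣ) -
          (U (x, q.1.2) * U (shift q.1.2 x, q.1.1) : 𝔸ˣ) * f (shift q.1.2 (shift q.1.1 x)) *
            ((U (x, q.1.2) * U (shift q.1.2 x, q.1.1))⁻¹ : 𝔸ˣ)) := by
  rw [covCurl_covDeriv, adTransport_apply, adTransport_apply, adTransport_apply, adTransport_apply]
  simp only [Units.val_mul, mul_inv_rev, Units.val_mul, mul_assoc]

/-! ## §3 (3.9): the adjoint `D*` on plaquette functions, its adjointness to the curl, and `D*D` on bond functions -/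

section CoCurl

open scoped BigOperators InnerProductSpace
open B9Eq33CovDerivVector (shiftEquiv covDiv)

variable [Fintype (Fin d)]

/-- **The adjoint (3.9) of the curl, on fibre-valued plaquette functions**: at the bond `⟨y, y + e_κ⟩`,
`(D*F)_κ(y) = Σ_{ν<κ} (D*_ν F_{νκ})(y) − Σ_{ν>κ} (D*_ν F_{κν})(y)` with the backward covariant difference
`(D*_ν G)(y) = c·(S(⟨y − e_ν, y⟩) G(y − e_ν) − G(y))` of (3.8) — print's `Σ_ν (D*_ν F_{νκ})(x)` with `F_{κν} = −F_{νκ}`; plaquettes indexed by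
ordered pairs `μ < ν` (`B9SectCLatticeCarrier.DirPair`), the adjoint transporters `S` a linear DATUM. [cite: Balaban1985BackgroundPropagators, (3.9) p.392] -/
def covCoCurl (c : 𝕜) (S : Bond d Pd → V →ₗ[𝕜] V) : (Plaq d Pd → V) →ₗ[𝕜] (Bond d Pd → V) where
  toFun F b := c • ((∑ q ∈ Finset.univ.filter (fun q : DirPair d => q.1.2 = b.2),
      (S (unshift q.1.1 b.1, q.1.1) (F (unshift q.1.1 b.1, q)) - F (b.1, q))) -
    ∑ q ∈ Finset.univ.filter (fun q : DirPair d => q.1.1 = b.2),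
      (S (unshift q.1.2 b.1, q.1.2) (F (unshift q.1.2 b.1, q)) - F (b.1, q)))
  map_add' F G := by
    funext b
    simp only [Pi.add_apply, map_add, Finset.sum_add_distrib, Finset.sum_sub_distrib, smul_add, smul_sub]
    abel
  map_smul' a F := by
    funext b
    simp only [Pi.smul_apply, map_smul, Finset.sum_sub_distrib, RingHom.id_apply, ← Finset.smul_sum, smul_sub, smul_comm c a]

/-- Unfolding (3.9). [cite: Balaban1985BackgroundPropagators, (3.9) p.392] -/
theorem covCoCurl_apply (c : 𝕜) (S : Bond d Pd → V →ₗ[𝕜] V) (F : Plaq d Pd → V) (y : TSite d Pd) (κ : Fin d) :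
    covCoCurl c S F (y, κ) = c • ((∑ q ∈ Finset.univ.filter (fun q : DirPair d => q.1.2 = κ),
      (S (unshift q.1.1 y, q.1.1) (F (unshift q.1.1 y, q)) - F (y, q))) -
    ∑ q ∈ Finset.univ.filter (fun q : DirPair d => q.1.1 = κ),
      (S (unshift q.1.2 y, q.1.2) (F (unshift q.1.2 y, q)) - F (y, q))) := rfl

variable {W : Type*} [NormedAddCommGroup W] [InnerProductSpace ℝ W]

/-- **(3.9) IS THE `ℓ²`-ADJOINT OF THE CURL (3.4)** (p. 392: *«The operator adjoint to derivative D, acting on functions defined at bonds, is the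
operator acting on functions F defined at plaquetts by the formula … (3.9)»*): on the periodic lattice, for real-inner-product fibres and mutually
adjoint transporter data (`⟪w, R(b)v⟫ = ⟪S(b)w, v⟫`), `Σ_p ⟪F(p), (DA)(p)⟫ = Σ_b ⟪(D*F)(b), A(b)⟫` (uniform lattice weights).
[cite: Balaban1985BackgroundPropagators, (3.9) p.392] -/
theorem sum_inner_covCurl_eq_sum_inner_covCoCurl (c : ℝ) (R S : Bond d Pd → W →ₗ[ℝ] W)
    (hRS : ∀ (b : Bond d Pd) (v w : W), ⟪w, R b v⟫_ℝ = ⟪S b w, v⟫_ℝ) (F : Plaq d Pd → W) (A : Bond d Pd → W) :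
    ∑ p, ⟪F p, covCurl c R A p⟫_ℝ = ∑ b, ⟪covCoCurl c S F b, A b⟫_ℝ := by
  -- the four families of terms, as functions of (site, pair)
  set T1 : TSite d Pd → DirPair d → ℝ := fun x q => c * ⟪S (x, q.1.1) (F (x, q)), A (shift q.1.1 x, q.1.2)⟫_ℝ with hT1
  set T2 : TSite d Pd → DirPair d → ℝ := fun x q => c * ⟪F (x, q), A (x, q.1.2)⟫_ℝ with hT2
  set T3 : TSite d Pd → DirPair d → ℝ := fun x q => c * ⟪S (x, q.1.2) (F (x, q)), A (shift q.1.2 x, q.1.1)⟫_ℝ with hT3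
  set T4 : TSite d Pd → DirPair d → ℝ := fun x q => c * ⟪F (x, q), A (x, q.1.1)⟫_ℝ with hT4
  -- LHS = Σ_x Σ_q (T1 − T2 − T3 + T4)
  have hL : ∑ p, ⟪F p, covCurl c R A p⟫_ℝ = ∑ x, ∑ q, (T1 x q - T2 x q - (T3 x q - T4 x q)) := by
    rw [Fintype.sum_prod_type]
    refine Finset.sum_congr rfl fun x _ => Finset.sum_congr rfl fun q _ => ?_
    rw [covCurl_apply_coord, inner_sub_right, real_inner_smul_right, real_inner_smul_right, inner_sub_right, inner_sub_right, hRS, hRS,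
      hT1, hT2, hT3, hT4, mul_sub, mul_sub]
  -- re-indexed first and third families: Σ_x T1 x q = Σ_y c⟪S(y−e,·)F(y−e,q), A(y,q.2)⟫ etc.
  have key1 : ∀ q : DirPair d, ∑ x : TSite d Pd, T1 x q =
      ∑ y : TSite d Pd, c * ⟪S (unshift q.1.1 y, q.1.1) (F (unshift q.1.1 y, q)), A (y, q.1.2)⟫_ℝ := fun q =>
    Fintype.sum_equiv (shiftEquiv q.1.1) _ _ fun x => by
      simp only [hT1, shiftEquiv, Equiv.coe_fn_mk, B9SectCLatticeCarrier.unshift_shift]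
  have key3 : ∀ q : DirPair d, ∑ x : TSite d Pd, T3 x q =
      ∑ y : TSite d Pd, c * ⟪S (unshift q.1.2 y, q.1.2) (F (unshift q.1.2 y, q)), A (y, q.1.1)⟫_ℝ := fun q =>
    Fintype.sum_equiv (shiftEquiv q.1.2) _ _ fun x => by
      simp only [hT3, shiftEquiv, Equiv.coe_fn_mk, B9SectCLatticeCarrier.unshift_shift]
  -- RHS = Σ_y Σ_κ c (Σ_{q.2=κ} (…) − Σ_{q.1=κ} (…)) = by fibrewise summation Σ_y Σ_q (…)
  have hR : ∑ b, ⟪covCoCurl c S F b, A b⟫_ℝ =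
      ∑ y, ((∑ q, (c * ⟪S (unshift q.1.1 y, q.1.1) (F (unshift q.1.1 y, q)), A (y, q.1.2)⟫_ℝ - T2 y q)) -
        ∑ q, (c * ⟪S (unshift q.1.2 y, q.1.2) (F (unshift q.1.2 y, q)), A (y, q.1.1)⟫_ℝ - T4 y q)) := by
    rw [Fintype.sum_prod_type]
    refine Finset.sum_congr rfl fun y _ => ?_
    have e : ∀ κ : Fin d, ⟪covCoCurl c S F (y, κ), A (y, κ)⟫_ℝ =
        (∑ q ∈ Finset.univ.filter (fun q : DirPair d => q.1.2 = κ),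
            (c * ⟪S (unshift q.1.1 y, q.1.1) (F (unshift q.1.1 y, q)), A (y, q.1.2)⟫_ℝ - T2 y q)) -
          ∑ q ∈ Finset.univ.filter (fun q : DirPair d => q.1.1 = κ),
            (c * ⟪S (unshift q.1.2 y, q.1.2) (F (unshift q.1.2 y, q)), A (y, q.1.1)⟫_ℝ - T4 y q) := by
      intro κ
      rw [covCoCurl_apply, real_inner_smul_left, inner_sub_left, sum_inner, sum_inner, mul_sub, Finset.mul_sum, Finset.mul_sum]
      congr 1
      · refine Finset.sum_congr rfl fun q hq => ?_
        rw [Finset.mem_filter] at hq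
        rw [inner_sub_left, mul_sub]
        simp only [hT2]
        rw [hq.2]
      · refine Finset.sum_congr rfl fun q hq => ?_
        rw [Finset.mem_filter] at hq
        rw [inner_sub_left, mul_sub]
        simp only [hT4]
        rw [hq.2]
    simp only [e]
    rw [Finset.sum_sub_distrib,
      Finset.sum_fiberwise Finset.univ (fun q : DirPair d => q.1.2)
        (fun q => c * ⟪S (unshift q.1.1 y, q.1.1) (F (unshift q.1.1 y, q)), A (y, q.1.2)⟫_ℝ - T2 y q),
      Finset.sum_fiberwise Finset.univ (fun q : DirPair d => q.1.1)
        (fun q => c * ⟪S (unshift q.1.2 y, q.1.2) (F (unshift q.1.2 y, q)), A (y, q.1.1)⟫_ℝ - T4 y q)]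
  rw [hL, hR]
  -- both sides are now Σ over sites of Σ over pairs; compare after swapping to Σ_q Σ_x
  simp only [Finset.sum_sub_distrib]
  rw [Finset.sum_comm (f := fun x q => T1 x q), Finset.sum_comm (f := fun x q => T3 x q),
    Finset.sum_comm (f := fun y q => c * ⟪S (unshift q.1.1 y, q.1.1) (F (unshift q.1.1 y, q)), A (y, q.1.2)⟫_ℝ),
    Finset.sum_comm (f := fun y q => c * ⟪S (unshift q.1.2 y, q.1.2) (F (unshift q.1.2 y, q)), A (y, q.1.1)⟫_ℝ)]
  simp only [key1, key3]

/-- **`D*D` ON BOND FUNCTIONS** — the principal part `D*D` of the operator `Δ` of (3.10) (*«the basic operator generalizing the operator ∂*∂ in the Abelian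
case»*; the remaining terms `Δ′` of (3.10) are the curvature commutators, not typed here): the composite of (3.9) with (3.4).
[cite: Balaban1985BackgroundPropagators, (3.10) p.392] -/
def covLapPrincipal (c : 𝕜) (R S : Bond d Pd → V →ₗ[𝕜] V) : (Bond d Pd → V) →ₗ[𝕜] (Bond d Pd → V) :=
  (covCoCurl c S).comp (covCurl c R)

/-- Unfolding: `D*D A = D*(DA)`. [cite: Balaban1985BackgroundPropagators, (3.10) p.392] -/
theorem covLapPrincipal_apply (c : 𝕜) (R S : Bond d Pd → V →ₗ[𝕜] V) (A : Bond d Pd → V) :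
    covLapPrincipal c R S A = covCoCurl c S (covCurl c R A) := rfl

/-- **`⟨A, D*DA⟩ = Σ_p |(DA)(p)|²`** — the first term of (3.10) `Σ_p η^d |(DA)(p)|²` (uniform weights omitted): for mutually adjoint transporter data
the principal part is a positive semidefinite form, vanishing exactly on the curl-free bond functions. [cite: Balaban1985BackgroundPropagators, (3.10) p.392] -/
theorem sum_inner_covLapPrincipal (c : ℝ) (R S : Bond d Pd → W →ₗ[ℝ] W)
    (hRS : ∀ (b : Bond d Pd) (v w : W), ⟪w, R b v⟫_ℝ = ⟪S b w, v⟫_ℝ) (A : Bond d Pd → W) :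
    ∑ b, ⟪covLapPrincipal c R S A b, A b⟫_ℝ = ∑ p, ‖covCurl c R A p‖ ^ 2 := by
  rw [covLapPrincipal_apply, ← sum_inner_covCurl_eq_sum_inner_covCoCurl c R S hRS]
  exact Finset.sum_congr rfl fun p _ => real_inner_self_eq_norm_sq _

/-- The principal part is POSITIVE SEMIDEFINITE: `0 ≤ ⟨A, D*DA⟩`. [cite: Balaban1985BackgroundPropagators, (3.10) p.392] -/
theorem sum_inner_covLapPrincipal_nonneg (c : ℝ) (R S : Bond d Pd → W →ₗ[ℝ] W)
    (hRS : ∀ (b : Bond d Pd) (v w : W), ⟪w, R b v⟫_ℝ = ⟪S b w, v⟫_ℝ) (A : Bond d Pd → W) :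
    0 ≤ ∑ b, ⟪covLapPrincipal c R S A b, A b⟫_ℝ := by
  rw [sum_inner_covLapPrincipal c R S hRS A]
  exact Finset.sum_nonneg fun p _ => sq_nonneg _

end CoCurl

end Literature.MathematicalPhysics.QuantumFieldTheory.Balaban1983to89.B9Eq34CovCurlVector

end
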